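import Summits.HodgeConjecture.CorCM.Census.TwistGenerationModel

/-!
# Uniform twist generation, X: THE SCREW VOCABULARY — the upper class `upCl a` and the arc type `arcTy s` of a column profile

COR-CM (cell `pub-hodgecm2`), count-neutral kernel combinatorics by the binder seat b09 (gen 37; lane UNIFORM TWIST GENERATION, part X — the first
file of the SCREW HALF), in seat b09ʼs intrinsic currency (`CMF G c`, `rt`, `oflipCM`: `CorCM/Prior/AllgGroup1.lean`, `Census/BlockParityLaw.lean`)
and on part II (`Census/TwistGenerationModel.lean`: `cst`, `ddist`, `pot`, `nearCl`) used BY NAME.  Two bookkeeping definitions with bodies (`upCl`,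
a `Set`; `arcTy`, a CM type) + their membership lemmas; no `Prop`-valued definition, no `decide`, no certificate, no named fact, no `sorry`.
HONEST FRAMING: `HC_CM` is NOT proved, here or anywhere in the tree; nothing here is a period or a headline.

THE POINT (parts X–XV, `Census/TwistScrew*.lean`).  Part VIII (`exists_gfaces_generate`) gives `μ(ℤ/2n × B, (n,0)) ≤ β − 1` for every `n ≥ 2`;
part IX the exact law `μ = β − 1` when no element of `B` has order divisible by `2n`.  The SCREW SAVING `μ ≤ β − 2` when some `t ∈ B` has
`2n ∣ ord t` was a kernel theorem for `n = 2` (`Census/QuarticTwistScrew*`) and `n = 4` (`Census/OcticTwistScrew*`) only, each by a level-specific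
orientation machinery.  Parts X–XV prove it UNIFORMLY IN `n`, with two new devices:

* **the upper class** `upCl a` (§1): the types whose set of nearest centres is an ARC OF ADJACENT CENTRES `{a, a − 1, …, a − ℓ + 1}` of length
  `ℓ ≤ n` with UPPER end `a` — it contains the near class of part II (`ℓ ≤ 2`), is base-change stable, uniquely indexed and closed under
  deviation flips toward `a` (part XI), so the star form `[Φ] ≡ θ_{cst a}(typeSum [Φ])` of part IV extends to it; and it CONTAINS THE SINGLE
  FLIPS OF THE SCREW TYPE (which is tied among all `2n` centres), with `ℓ = n`;
* **the arc type** `arcTy s` of a column profile `s : B → ℤ/2n` (§2): column `b` at the arc `s b`.  The centres are the constant profiles, the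
  profile types of part II the indicator profiles, and the SCREW TYPE of part XIV is the arc type of a screw profile `s (b + t) = s b + 1`
  (which exists iff `2n ∣ ord t`), fixed by the base change along `θ⁻¹(1, t)` (`rt_arcTy`).

## References
* [Pohlmann1968] H. Pohlmann, Algebraic cycles on abelian varieties of complex multiplication type, Ann. of Math. 88 (1968), Thm 1.
* [Milne1999] J. S. Milne, Lefschetz motives and the Tate conjecture, Compositio Math. 117 (1999), Prop. 2.1, p. 54.
-/

namespace Summit.HodgeConjecture.CorCM.Census.TwistGeneration

open Finset
open Summit.HodgeConjecture.CorCM.Prior.AllgGroup.RfwfAllgGroup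
open Summit.HodgeConjecture.CorCM.Census.BlockParity

noncomputable section

variable {G : Type*} [Group G] [Fintype G] [DecidableEq G] {c : G}
variable {B : Type} [AddGroup B]
variable {n : ℕ} [NeZero n] (θ : G ≃ ZMod (2 * n) × B)
variable (hθ : ∀ P Q : G, θ (P * Q) = θ P + θ Q) (hθc : θ c = (((n : ℕ) : ZMod (2 * n)), 0))

/-! ## §1 The upper class -/

/-- **The upper class** `upCl a`: the types `Ψ` whose nearest centres (those realising the potential) are EXACTLY the adjacent centres
`a, a − 1, …, a − ℓ + 1` for some `1 ≤ ℓ ≤ n` — an arc of centres of length at most `n` with upper end `a`.  For `ℓ ≤ 2` this is the near class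
`nearCl a` of part II (unique nearest centre, or the upper end of an adjacent tie). [folklore] -/
def upCl (a : ZMod (2 * n)) : Set (CMF G c) :=
  {Ψ | ∃ ℓ : ℕ, 1 ≤ ℓ ∧ ℓ ≤ n ∧ ∀ a' : ZMod (2 * n), ddist (cst θ hθ hθc a') Ψ = pot θ hθ hθc Ψ ↔ (a - a').val < ℓ}

/-- Membership in the upper class. [folklore] -/
theorem mem_upCl_iff (a : ZMod (2 * n)) (Ψ : CMF G c) : Ψ ∈ upCl θ hθ hθc a ↔
    ∃ ℓ : ℕ, 1 ≤ ℓ ∧ ℓ ≤ n ∧ ∀ a' : ZMod (2 * n), ddist (cst θ hθ hθc a') Ψ = pot θ hθ hθc Ψ ↔ (a - a').val < ℓ := Iff.rfl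

/-- **On the upper class the potential is the distance to the upper centre.** [folklore] -/
theorem pot_eq_of_up {a : ZMod (2 * n)} {Ψ : CMF G c} (h : Ψ ∈ upCl θ hθ hθc a) : pot θ hθ hθc Ψ = ddist (cst θ hθ hθc a) Ψ := by
  obtain ⟨ℓ, h1, -, h3⟩ := h
  exact ((h3 a).mpr (by rw [sub_self, ZMod.val_zero]; omega)).symm

/-! ## §2 The arc type of a column profile -/

/-- **The arc type `arcTy s` of a column profile `s : B → ℤ/2n`**: column `b` sits at the arc `s b`, i.e.
`P ∈ arcTy s ↔ ((θP).1 − s (θP).2).val < n`.  (`cst a` is the constant profile `a`, `prof Q` the profile `[· ∈ Q]`.) [folklore] -/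
def arcTy (s : B → ZMod (2 * n)) : CMF G c :=
  ⟨univ.filter fun P => ((θ P).1 - s (θ P).2).val < n, by
    intro x
    simp only [mem_filter, mem_univ, true_and, fst_c_mul θ hθ hθc, snd_c_mul θ hθ hθc, add_sub_right_comm]
    exact lt_iff_not_lt_add_n _⟩

/-- Membership in an arc type. [folklore] -/
@[simp] theorem mem_arcTy (s : B → ZMod (2 * n)) (P : G) : P ∈ (arcTy θ hθ hθc s).1 ↔ ((θ P).1 - s (θ P).2).val < n := by
  simp [arcTy]

/-- Membership of `θ⁻¹(x, b)` in an arc type. [folklore] -/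
theorem symm_mem_arcTy (s : B → ZMod (2 * n)) (x : ZMod (2 * n)) (b : B) :
    θ.symm (x, b) ∈ (arcTy θ hθ hθc s).1 ↔ (x - s b).val < n := by
  rw [mem_arcTy, Equiv.apply_symm_apply]

/-- **Base change of an arc type is an arc type**: `(arcTy s)·Q⁻¹ = arcTy (b ↦ s (b + (θQ).2) − (θQ).1)`. [folklore] -/
theorem rt_arcTy (Q : G) (s : B → ZMod (2 * n)) :
    rt c Q (arcTy θ hθ hθc s) = arcTy θ hθ hθc fun b => s (b + (θ Q).2) - (θ Q).1 := by
  apply Subtype.ext; ext P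
  rw [mem_rt, mem_arcTy, mem_arcTy, hθ, Prod.fst_add, Prod.snd_add,
    show (θ P).1 + (θ Q).1 - s ((θ P).2 + (θ Q).2) = (θ P).1 - (s ((θ P).2 + (θ Q).2) - (θ Q).1) by abel]

/-- The centre `cst a` is the arc type of the constant profile `a`. [folklore] -/
theorem arcTy_const (a : ZMod (2 * n)) : arcTy θ hθ hθc (fun _ => a) = cst θ hθ hθc a := by
  apply Subtype.ext; ext P
  rw [mem_arcTy, mem_cst]

end

end Summit.HodgeConjecture.CorCM.Census.TwistGeneration
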